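import Mathlib.LinearAlgebra.Vandermonde
import Mathlib.LinearAlgebra.Matrix.Block
import Mathlib.RingTheory.Polynomial.Pochhammer
import Mathlib.Data.Nat.Choose.Sum
import Mathlib.Data.Nat.Factorial.SuperFactorial
import Literature.Analysis.TotalPositivity.PolyaFrequency
import HarnessLib

/-!
# Solid Toeplitz minors of the coefficient sequence of `e^w · P(w/R)` — an exact formula

Trunk T-ANALYSIS (Literature/Analysis/TotalPositivity). Algebraic core of the tree's proof of
Katkova's Theorem 3 [Katkova2006, Thm. 3: `e^{nz} ξ₁(z), cosh(n√z) ξ₁(z) ∈ PF_m` for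
`n ≥ n₀(m)`], see `Literature/NumberTheory/LFunctions/XiMultiplePositivityExpFactors.lean`.
Katkova's own route (§§2–4: Pólya's composition formula and a two-parameter saddle-point
analysis) is replaced in the tree by an elementary argument whose heart is the following
EXACT evaluation of the solid Toeplitz minors of the Maclaurin coefficients

  `c_k = Σ_{j ≤ r} p_j R^{-j} / (k-j)!`   (`1/(negative)! := 0`)

of `e^w P(w/R)`, `P(x) = Σ_{j ≤ r} p_j x^j` a real polynomial:

  `T_{n+1}(k) := det (c_{k+a-b})_{a,b ≤ n} = ε · det N'`,
  `N'_{b,a} = Σ_{j ≤ r} p_j R^{-j} · invFact (k+n-b-j) · (-(b+j))^a`,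

`ε = sign (rev) = ±1` (`toeplitzMinor_expPolySeq`). Ingredients: expansion of the determinant
along the columns (`det_of_row_sum`), the **binomial alternant**

  `det (invFact (t_b + a))_{a,b ≤ n} = ε · V(t_0+n, …, t_n+n) · ∏_b invFact (t_b + n)`

(`det_invFact_add`; `invFact (u - j) = u(u-1)⋯(u-j+1) · invFact u` turns column `b` into
`invFact (t_b+n) ×` (the descending factorials of `t_b + n`), and Mathlib's
`det_eval_matrixOfPolynomials_eq_det_vandermonde`), and re-summation along the rows. Two
further identities prepare the positivity proof (`ExpPolyMultiplyPositive.lean`): after scaling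
row `b` by `(k+n-b)!` the entries become `Σ_j p_j R^{-j} (k+n-b)(k+n-b-1)⋯(k+n-b-j+1) (-(b+j))^a`
(`det_scaledMatrix`), whose "main term" (`(k+n-b)⋯ ≈ k^j`, `x = k/R`)
`m_{b,a} = Σ_j p_j x^j (-(b+j))^a` is (Vandermonde in `-b`) × (upper triangular with diagonal
`P(x)`), so that `ε · det m = sf(n) · P(x)^{n+1}` with `sf(n) = 1!2!⋯n! > 0`
(`det_mainMatrix`, `sign_rev_mul_det_vandermonde_neg`).

## References

* O. M. Katkova, *Multiple positivity and the Riemann zeta-function*, CMFT 7 (2007) 13–31;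
  arXiv:math/0505174, Thm. 3 and §2. [Katkova2006]
* S. Karlin, *Total Positivity* I, Stanford UP 1968, Ch. 8 §1 (the `PF_∞` sequence `1/k!`).
  [Karlin1968]
-/

noncomputable section

open Finset Matrix Polynomial

namespace Literature.Analysis.TotalPositivity

/-! ### `1/n!` on `ℤ` -/

/-- `invFact n = 1/n!` for `n ≥ 0` and `0` for `n < 0` (the Maclaurin coefficients of `e^w`,
extended by `0`). [folklore] -/
def invFact (n : ℤ) : ℝ :=
  if 0 ≤ n then ((n.toNat.factorial : ℕ) : ℝ)⁻¹ else 0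

/-- `invFact n = 1/n!` on naturals. [folklore] -/
@[simp] theorem invFact_natCast (n : ℕ) : invFact n = ((n.factorial : ℕ) : ℝ)⁻¹ := by
  simp [invFact]

/-- `invFact n = 0` for `n < 0`. [folklore] -/
theorem invFact_of_neg {n : ℤ} (h : n < 0) : invFact n = 0 := by
  simp [invFact, not_le.2 h]

/-- `0 ≤ invFact n`. [folklore] -/
theorem invFact_nonneg (n : ℤ) : 0 ≤ invFact n := by
  unfold invFact
  split_ifs <;> positivity

/-- The recursion `invFact n = (n+1) · invFact (n+1)`, valid on all of `ℤ`. [folklore] -/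
theorem invFact_eq_succ_mul (n : ℤ) : invFact n = ((n : ℝ) + 1) * invFact (n + 1) := by
  rcases lt_trichotomy n (-1) with h | rfl | h
  · rw [invFact_of_neg (by omega), invFact_of_neg (by omega), mul_zero]
  · rw [invFact_of_neg (by norm_num)]
    push_cast
    ring
  · obtain ⟨m, rfl⟩ := Int.eq_ofNat_of_zero_le (by omega : 0 ≤ n)
    rw [show (m : ℤ) + 1 = ((m + 1 : ℕ) : ℤ) by push_cast; ring, invFact_natCast, invFact_natCast,
      Nat.factorial_succ]
    push_cast
    have : ((m.factorial : ℕ) : ℝ) ≠ 0 := by exact_mod_cast m.factorial_ne_zero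
    field_simp

/-- **Descending factorials**: `invFact (u - j) = u(u-1)⋯(u-j+1) · invFact u` for all `u ∈ ℤ`
(both sides vanish when `0 ≤ u < j` or `u < 0`). [folklore] -/
theorem invFact_sub_natCast (u : ℤ) (j : ℕ) :
    invFact (u - j) = (descPochhammer ℝ j).eval (u : ℝ) * invFact u := by
  induction j with
  | zero => simp
  | succ j ih =>
    rw [descPochhammer_succ_eval, invFact_eq_succ_mul,
      show u - ((j + 1 : ℕ) : ℤ) + 1 = u - (j : ℕ) by push_cast; ring, ih]
    push_cast
    ring

/-- For naturals `K, j`: `K! · invFact (K - j) = K(K-1)⋯(K-j+1) = ∏_{l<j} (K - l)`. [folklore] -/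
theorem factorial_mul_invFact_sub (K j : ℕ) :
    ((K.factorial : ℕ) : ℝ) * invFact ((K : ℤ) - j) = ∏ l ∈ range j, ((K : ℝ) - l) := by
  rw [invFact_sub_natCast, ← descPochhammer_eval_eq_prod_range, Int.cast_natCast, invFact_natCast]
  have : ((K.factorial : ℕ) : ℝ) ≠ 0 := by exact_mod_cast K.factorial_ne_zero
  field_simp

/-! ### Expanding a determinant along sums in the rows -/

/-- **Multilinearity in the rows**: if row `b` of a matrix is `Σ_{j ∈ s} w_{b,j} · v_{b,j}` then
its determinant is `Σ_f (∏_b w_{b,f b}) · det (v_{b,f b})_b`, the sum over all choices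
`f : rows → s`. [folklore] -/
theorem det_of_row_sum {n : ℕ} {ι : Type*} (s : Finset ι) (w : Fin n → ι → ℝ)
    (v : Fin n → ι → Fin n → ℝ) :
    (Matrix.of fun b a => ∑ j ∈ s, w b j * v b j a).det =
      ∑ f ∈ Fintype.piFinset (fun _ : Fin n => s),
        (∏ b, w b (f b)) * (Matrix.of fun b a => v b (f b) a).det := by
  have key : ∀ M : Matrix (Fin n) (Fin n) ℝ,
      M.det = ∑ σ : Equiv.Perm (Fin n), ((Equiv.Perm.sign σ : ℤ) : ℝ) * ∏ b, M b (σ b) := by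
    intro M
    rw [← Matrix.det_transpose, Matrix.det_apply']
    rfl
  rw [key]
  simp_rw [key (Matrix.of fun b a => v b _ a), Matrix.of_apply]
  calc ∑ σ : Equiv.Perm (Fin n), ((Equiv.Perm.sign σ : ℤ) : ℝ) * ∏ b, ∑ j ∈ s, w b j * v b j (σ b)
      = ∑ σ : Equiv.Perm (Fin n), ∑ f ∈ Fintype.piFinset (fun _ : Fin n => s),
          ((Equiv.Perm.sign σ : ℤ) : ℝ) * ((∏ b, w b (f b)) * ∏ b, v b (f b) (σ b)) := by
        refine Finset.sum_congr rfl fun σ _ => ?_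
        rw [Finset.prod_univ_sum, Finset.mul_sum]
        refine Finset.sum_congr rfl fun f _ => ?_
        rw [Finset.prod_mul_distrib]
    _ = ∑ f ∈ Fintype.piFinset (fun _ : Fin n => s), (∏ b, w b (f b)) *
          ∑ σ : Equiv.Perm (Fin n), ((Equiv.Perm.sign σ : ℤ) : ℝ) * ∏ b, v b (f b) (σ b) := by
        rw [Finset.sum_comm]
        refine Finset.sum_congr rfl fun f _ => ?_
        rw [Finset.mul_sum]
        refine Finset.sum_congr rfl fun σ _ => ?_
        ring

/-! ### The binomial alternant -/

/-- `ε = sign` of the order-reversing permutation of `Fin (n+1)` (`= (-1)^{n(n+1)/2}`; only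
`ε² = 1` is ever used), as a real number. [folklore] -/
def revSign (n : ℕ) : ℝ := ((Equiv.Perm.sign (@Fin.revPerm (n + 1)) : ℤ) : ℝ)

/-- `ε² = 1`. [folklore] -/
theorem revSign_mul_self (n : ℕ) : revSign n * revSign n = 1 := by
  unfold revSign
  rw [← Int.cast_mul, ← Units.val_mul, Int.units_mul_self]
  simp

/-- `|ε| = 1`. [folklore] -/
theorem abs_revSign (n : ℕ) : |revSign n| = 1 := by
  unfold revSign
  rcases Int.units_eq_one_or (Equiv.Perm.sign (@Fin.revPerm (n + 1))) with h | h <;> simp [h]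

/-- **The binomial alternant.** For integers `t_0, …, t_n`,
`det (invFact (t_b + a))_{a,b ≤ n} = ε · V(t_0 + n, …, t_n + n) · ∏_b invFact (t_b + n)`, where
`V(u) = det (u_b^a) = ∏_{b<b'} (u_{b'} - u_b)` is the Vandermonde determinant: column `b` equals
`invFact (t_b + n)` times the vector of descending factorials `(t_b+n)(t_b+n-1)⋯` of lengths
`n, n-1, …, 0`, i.e. of monic polynomials of degrees `n - a` evaluated at `t_b + n`. (For the
`PF_∞` sequence `1/k!` this is the classical positivity of its minors with consecutive rows.)
[Karlin1968, Ch. 8 §1] [folklore] -/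
theorem det_invFact_add (n : ℕ) (t : Fin (n + 1) → ℤ) :
    (Matrix.of fun (a b : Fin (n + 1)) => invFact (t b + (a : ℕ))).det =
      revSign n * (Matrix.vandermonde fun b => ((t b : ℝ) + n)).det *
        ∏ b, invFact (t b + n) := by
  have hentry : ∀ a b : Fin (n + 1), invFact (t b + (a : ℕ)) =
      invFact (t b + n) * (descPochhammer ℝ (Fin.rev a : ℕ)).eval ((t b : ℝ) + n) := by
    intro a b
    have h1 : t b + ((a : ℕ) : ℤ) = (t b + n) - ((Fin.rev a : ℕ) : ℤ) := by
      rw [Fin.val_rev]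
      have := a.2
      push_cast
      omega
    rw [h1, invFact_sub_natCast]
    push_cast
    ring
  have hM : (Matrix.of fun (a b : Fin (n + 1)) => invFact (t b + (a : ℕ))) =
      Matrix.of fun (i j : Fin (n + 1)) => (fun b => invFact (t b + n)) j *
        (Matrix.of fun (a b : Fin (n + 1)) =>
          (descPochhammer ℝ (Fin.rev a : ℕ)).eval ((t b : ℝ) + n)) i j := by
    ext a b
    simp only [Matrix.of_apply]
    exact hentry a b
  rw [hM, Matrix.det_mul_row]
  have hT : (Matrix.of fun (a b : Fin (n + 1)) =>
      (descPochhammer ℝ (Fin.rev a : ℕ)).eval ((t b : ℝ) + n)).det =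
      revSign n * (Matrix.vandermonde fun b => ((t b : ℝ) + n)).det := by
    rw [← Matrix.det_transpose]
    have h2 : (Matrix.of fun (a b : Fin (n + 1)) =>
        (descPochhammer ℝ (Fin.rev a : ℕ)).eval ((t b : ℝ) + n)).transpose =
        (Matrix.of fun (b a : Fin (n + 1)) =>
          (descPochhammer ℝ (a : ℕ)).eval ((t b : ℝ) + n)).submatrix id Fin.revPerm := by
      ext b a
      rfl
    rw [h2, Matrix.det_permute', revSign,
      det_eval_matrixOfPolynomials_eq_det_vandermonde (fun b => ((t b : ℝ) + n))
        (fun a => descPochhammer ℝ (a : ℕ)) (fun a => descPochhammer_natDegree ℝ a)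
        (fun a => monic_descPochhammer ℝ a)]
  rw [hT]
  ring

/-! ### The coefficient sequence of `e^w P(w/R)` and its solid minors -/

/-- The Maclaurin coefficients `c_k = Σ_{j ≤ r} p_j R^{-j}/(k-j)!` of `e^w · P(w/R)`,
`P(x) = Σ_{j ≤ r} p_j x^j`. [cite: Katkova2006, §2 (f²_ε = e^z f¹(εz))] -/
def expPolySeq (p : ℕ → ℝ) (r : ℕ) (R : ℝ) (k : ℕ) : ℝ :=
  ∑ j ∈ range (r + 1), p j * R⁻¹ ^ j * invFact ((k : ℤ) - j)

/-- The two-sided extension of `expPolySeq` is given by the same formula on all of `ℤ`.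
[folklore] -/
theorem seqZ_expPolySeq (p : ℕ → ℝ) (r : ℕ) (R : ℝ) (z : ℤ) :
    seqZ (expPolySeq p r R) z = ∑ j ∈ range (r + 1), p j * R⁻¹ ^ j * invFact (z - j) := by
  unfold seqZ
  split_ifs with h
  · obtain ⟨k, rfl⟩ := Int.eq_ofNat_of_zero_le h
    simp [expPolySeq]
  · symm
    refine Finset.sum_eq_zero fun j _ => ?_
    rw [invFact_of_neg (by push Not at h; omega), mul_zero]

/-- The matrix `N'`: `N'_{b,a} = Σ_{j ≤ r} p_j R^{-j} invFact (k+n-b-j) (-(b+j))^a`. [folklore] -/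
def altMatrix (p : ℕ → ℝ) (r : ℕ) (R : ℝ) (n k : ℕ) : Matrix (Fin (n + 1)) (Fin (n + 1)) ℝ :=
  Matrix.of fun b a => ∑ j ∈ range (r + 1),
    p j * R⁻¹ ^ j * invFact ((k : ℤ) + n - (b : ℕ) - j) * (-((b : ℝ) + j)) ^ (a : ℕ)

/-- **The exact formula** `T_{n+1}(k) = ε · det N'` for the solid Toeplitz minor (rows
`k, …, k+n`, columns `0, …, n`) of the coefficient sequence of `e^w P(w/R)`: expand along the
columns (`c_{k+a-b} = Σ_j p_j R^{-j} invFact ((k-b-j) + a)`), evaluate each binomial alternant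
(`det_invFact_add`, translating the Vandermonde by `-(k+n)`), and re-sum along the rows.
[cite: Katkova2006, Thm. 3 (tree proof)] -/
theorem toeplitzMinor_expPolySeq (p : ℕ → ℝ) (r : ℕ) (R : ℝ) (n k : ℕ) :
    toeplitzMinor (expPolySeq p r R) (fun i : Fin (n + 1) => k + (i : ℕ))
        (fun j : Fin (n + 1) => (j : ℕ)) = revSign n * (altMatrix p r R n k).det := by
  unfold toeplitzMinor
  have hcol : (Matrix.of fun (a b : Fin (n + 1)) =>
      seqZ (expPolySeq p r R) (((k + (a : ℕ) : ℕ) : ℤ) - (b : ℕ))) =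
      (Matrix.of fun (b a : Fin (n + 1)) => ∑ j ∈ range (r + 1),
        (p j * R⁻¹ ^ j) * invFact (((k : ℤ) - (b : ℕ) - j) + (a : ℕ))).transpose := by
    ext a b
    simp only [Matrix.of_apply, Matrix.transpose_apply, seqZ_expPolySeq]
    refine Finset.sum_congr rfl fun j _ => ?_
    congr 1
    push_cast
    ring
  rw [hcol, Matrix.det_transpose, det_of_row_sum]
  -- evaluate each alternant
  have hinner : ∀ f : Fin (n + 1) → ℕ,
      (Matrix.of fun (b a : Fin (n + 1)) => invFact (((k : ℤ) - (b : ℕ) - f b) + (a : ℕ))).det =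
        revSign n * (Matrix.vandermonde fun b : Fin (n + 1) => -((b : ℝ) + f b)).det *
          ∏ b : Fin (n + 1), invFact ((k : ℤ) + n - (b : ℕ) - f b) := by
    intro f
    rw [← Matrix.det_transpose]
    have h1 : (Matrix.of fun (b a : Fin (n + 1)) =>
        invFact (((k : ℤ) - (b : ℕ) - f b) + (a : ℕ))).transpose =
        Matrix.of fun (a b : Fin (n + 1)) => invFact (((k : ℤ) - (b : ℕ) - f b) + (a : ℕ)) := by
      ext a b
      rfl
    rw [h1, det_invFact_add n (fun b => (k : ℤ) - (b : ℕ) - f b)]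
    have h2 : (fun b : Fin (n + 1) => ((((k : ℤ) - (b : ℕ) - f b : ℤ)) : ℝ) + n) =
        fun b : Fin (n + 1) => -((b : ℝ) + f b) + ((k : ℝ) + n) := by
      funext b
      push_cast
      ring
    rw [h2, Matrix.det_vandermonde_add]
    congr 1
    refine Finset.prod_congr rfl fun b _ => ?_
    congr 1
    ring
  simp_rw [hinner]
  -- re-sum along the rows
  unfold altMatrix
  rw [det_of_row_sum (range (r + 1))
    (fun (b : Fin (n + 1)) (j : ℕ) => p j * R⁻¹ ^ j * invFact ((k : ℤ) + n - (b : ℕ) - j))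
    (fun (b : Fin (n + 1)) (j : ℕ) (a : Fin (n + 1)) => (-((b : ℝ) + j)) ^ (a : ℕ)),
    Finset.mul_sum]
  refine Finset.sum_congr rfl fun f _ => ?_
  have hv : (Matrix.of fun (b a : Fin (n + 1)) => (-((b : ℝ) + f b)) ^ (a : ℕ)) =
      Matrix.vandermonde fun b : Fin (n + 1) => -((b : ℝ) + f b) := by
    ext b a
    simp [Matrix.vandermonde_apply]
  rw [hv]
  simp only [Finset.prod_mul_distrib]
  ring

/-! ### Row scaling and the main term -/

/-- The row-scaled matrix `N = diag((k+n-b)!) · N'`: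
`N_{b,a} = Σ_j p_j R^{-j} · ∏_{l<j} (k+n-b-l) · (-(b+j))^a`. [folklore] -/
def scaledMatrix (p : ℕ → ℝ) (r : ℕ) (R : ℝ) (n k : ℕ) : Matrix (Fin (n + 1)) (Fin (n + 1)) ℝ :=
  Matrix.of fun b a => ∑ j ∈ range (r + 1),
    p j * R⁻¹ ^ j * (∏ l ∈ range j, (((k + (n - (b : ℕ)) : ℕ) : ℝ) - l)) * (-((b : ℝ) + j)) ^ (a : ℕ)

/-- `det N = (∏_b (k+n-b)!) · det N'`. [folklore] -/
theorem det_scaledMatrix (p : ℕ → ℝ) (r : ℕ) (R : ℝ) (n k : ℕ) :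
    (scaledMatrix p r R n k).det =
      (∏ b : Fin (n + 1), (((k + (n - (b : ℕ))).factorial : ℕ) : ℝ)) * (altMatrix p r R n k).det := by
  unfold altMatrix
  rw [← Matrix.det_mul_column]
  unfold scaledMatrix
  congr 1
  ext b a
  simp only [Matrix.of_apply, Finset.mul_sum]
  refine Finset.sum_congr rfl fun j _ => ?_
  have hb : (b : ℕ) ≤ n := Nat.lt_succ_iff.1 b.2
  have hK : ((k : ℤ) + n - (b : ℕ) - j) = (((k + (n - (b : ℕ)) : ℕ) : ℤ) - j) := by
    push_cast [hb]
    ring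
  rw [hK, ← factorial_mul_invFact_sub]
  ring

/-- The main-term matrix `m_{b,a} = Σ_j p_j x^j (-(b+j))^a`. [folklore] -/
def mainMatrix (p : ℕ → ℝ) (r n : ℕ) (x : ℝ) : Matrix (Fin (n + 1)) (Fin (n + 1)) ℝ :=
  Matrix.of fun b a => ∑ j ∈ range (r + 1), p j * x ^ j * (-((b : ℝ) + j)) ^ (a : ℕ)

/-- **`det m = V(0, -1, …, -n) · P(x)^{n+1}`**: `m = (Vandermonde in -b) · U` with `U` upper
triangular, `U_{e,a} = binom(a,e) Σ_j p_j x^j (-j)^{a-e}`, diagonal `P(x)`. [folklore] -/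
theorem det_mainMatrix (p : ℕ → ℝ) (r n : ℕ) (x : ℝ) :
    (mainMatrix p r n x).det =
      (Matrix.vandermonde fun b : Fin (n + 1) => -(b : ℝ)).det *
        (∑ j ∈ range (r + 1), p j * x ^ j) ^ (n + 1) := by
  set U : Matrix (Fin (n + 1)) (Fin (n + 1)) ℝ := Matrix.of fun e a =>
    if (e : ℕ) ≤ (a : ℕ) then (Nat.choose a e : ℝ) *
      ∑ j ∈ range (r + 1), p j * x ^ j * (-(j : ℝ)) ^ ((a : ℕ) - e) else 0 with hU
  have hMU : mainMatrix p r n x = (Matrix.vandermonde fun b : Fin (n + 1) => -(b : ℝ)) * U := by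
    ext b a
    simp only [mainMatrix, Matrix.mul_apply, Matrix.vandermonde_apply, Matrix.of_apply, hU]
    -- right-hand side as a sum over `e ≤ a`
    have hR : ∑ e : Fin (n + 1), (-(b : ℝ)) ^ (e : ℕ) *
        (if (e : ℕ) ≤ (a : ℕ) then (Nat.choose a e : ℝ) *
          ∑ j ∈ range (r + 1), p j * x ^ j * (-(j : ℝ)) ^ ((a : ℕ) - e) else 0) =
        ∑ e ∈ range ((a : ℕ) + 1), (-(b : ℝ)) ^ e * ((Nat.choose a e : ℝ) *
          ∑ j ∈ range (r + 1), p j * x ^ j * (-(j : ℝ)) ^ ((a : ℕ) - e)) := by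
      rw [Fin.sum_univ_eq_sum_range (fun e => (-(b : ℝ)) ^ e *
        (if e ≤ (a : ℕ) then (Nat.choose a e : ℝ) *
          ∑ j ∈ range (r + 1), p j * x ^ j * (-(j : ℝ)) ^ ((a : ℕ) - e) else 0)) (n + 1)]
      have hsub : range ((a : ℕ) + 1) ⊆ range (n + 1) := by
        intro e he
        simp only [mem_range] at he ⊢
        have := a.2
        omega
      rw [← Finset.sum_subset hsub]
      · refine Finset.sum_congr rfl fun e he => ?_
        rw [if_pos (by simpa [Nat.lt_succ_iff] using he)]
      · intro e _ he
        rw [if_neg (by simpa [Nat.lt_succ_iff] using he), mul_zero]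
    rw [hR]
    -- left-hand side by the binomial theorem
    have hL : ∀ j ∈ range (r + 1), p j * x ^ j * (-((b : ℝ) + j)) ^ (a : ℕ) =
        ∑ e ∈ range ((a : ℕ) + 1), (-(b : ℝ)) ^ e * ((Nat.choose a e : ℝ) *
          (p j * x ^ j * (-(j : ℝ)) ^ ((a : ℕ) - e))) := by
      intro j _
      rw [neg_add, add_pow, Finset.mul_sum]
      refine Finset.sum_congr rfl fun e _ => ?_
      ring
    rw [Finset.sum_congr rfl hL, Finset.sum_comm]
    refine Finset.sum_congr rfl fun e _ => ?_
    rw [Finset.mul_sum, Finset.mul_sum]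
  have hUt : U.BlockTriangular id := by
    intro e a hlt
    simp only [hU, Matrix.of_apply]
    rw [if_neg]
    simpa using hlt
  rw [hMU, Matrix.det_mul, Matrix.det_of_upperTriangular hUt]
  congr 1
  have hdiag : ∀ a : Fin (n + 1), U a a = ∑ j ∈ range (r + 1), p j * x ^ j := by
    intro a
    simp only [hU, Matrix.of_apply, le_refl, if_true, Nat.choose_self, Nat.cast_one, one_mul,
      Nat.sub_self, pow_zero, mul_one]
  rw [Finset.prod_congr rfl fun a _ => hdiag a, Finset.prod_const, Finset.card_univ,
    Fintype.card_fin]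

/-- **`ε · V(0, -1, …, -n) = sf(n) = 1!·2!⋯n!`**: permuting the rows of the Vandermonde matrix
of `(0, -1, …, -n)` by `rev` gives the Vandermonde matrix of `(b - n)_b`, a translate of
`(0, 1, …, n)` (`det_vandermonde_id_eq_superFactorial`). [folklore] -/
theorem sign_rev_mul_det_vandermonde_neg (n : ℕ) :
    revSign n * (Matrix.vandermonde fun b : Fin (n + 1) => -(b : ℝ)).det = n.superFactorial := by
  rw [revSign, ← Matrix.det_permute]
  have h : (Matrix.vandermonde fun b : Fin (n + 1) => -(b : ℝ)).submatrix Fin.revPerm id =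
      Matrix.vandermonde fun b : Fin (n + 1) => (b : ℝ) - n := by
    ext b a
    simp only [Matrix.submatrix_apply, Matrix.vandermonde_apply, id_eq, Fin.revPerm_apply,
      Fin.val_rev, Nat.add_sub_add_right]
    have hb : (b : ℕ) ≤ n := Nat.lt_succ_iff.1 b.2
    rw [Nat.cast_sub hb]
    ring
  rw [h, Matrix.det_vandermonde_sub, Matrix.det_vandermonde_id_eq_superFactorial]

/-- Hence the main term: `ε · det m = sf(n) · P(x)^{n+1}`. [folklore] -/
theorem sign_rev_mul_det_mainMatrix (p : ℕ → ℝ) (r n : ℕ) (x : ℝ) :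
    revSign n * (mainMatrix p r n x).det =
      n.superFactorial * (∑ j ∈ range (r + 1), p j * x ^ j) ^ (n + 1) := by
  rw [det_mainMatrix, ← mul_assoc, sign_rev_mul_det_vandermonde_neg]

end Literature.Analysis.TotalPositivity
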